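import Mathlib
import Summits.Ventures.PercRepro2.Defs
import Summits.Ventures.PercRepro2.Graph
import Summits.Ventures.PercRepro2.Events
import Summits.Ventures.PercRepro2.CycleDefs

/-!
# The antipodal 2-colouring term on a cycle and its injection (blind cell PercRepro2, mine-a g47)

Colour the edges of a set `D` of positions of the cycle: `τ ⊆ D` red (closed in the first copy),
`D ∖ τ` blue (closed in the second copy).  With the arcs `arc τ`, `arc (D ∖ τ)` of `CycleDefs`
(the root clusters of the two copies) and up-sets `𝓤 𝓥` of vertex sets, the term of the
antipodal sum at `τ` is

  `wt τ = 1[h ∈ arc τ] · (1[arc τ ∈ 𝓤] − 1[arc (D∖τ) ∈ 𝓤]) · (1[arc τ ∈ 𝓥] − 1[arc (D∖τ) ∈ 𝓥]) ∈ {−1, 0, 1}`.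

This file: the arcs of the one-sided colourings (red at `min D`, blue at `max D` and the mirror),
the images `flipLow` / `flipHigh` (the colouring with red hull `[f, l]`) and the map `phi` of the
counting proof of MINE-A.md §102.2, the sets of negative and positive colourings, the identity
`Σ wt = #positive − #negative`, and the first facts on negative colourings: they contain exactly
one of `min D`, `max D`, the arc of `D` lies in neither family and everything lies in both.  The map
`phi` is proved injective on the negative colourings (with positive images) in the later files of
the chain ONLY under the hypothesis that `h` lies strictly inside the hull of `D`
(`min D < h ≤ max D`); without it a red set and its complement can both be negative and share the
image (e.g. `h = 0`), and that case (every arc contains `h`) is the comparable Kleitman form of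
`AntipodalKleitman` instead.  proofs/MINEA-CYCLE.md.  No instance, no notation.
-/

namespace Summit.Ventures.PercRepro2

namespace TCycle

open Finset

variable {n : ℕ}
/-! ## Arcs through their extreme closed edges -/

/-- The arc of a closed set with a least element `a` and a greatest element `b` is
`V ∖ (a, b] = {v | v ≤ a ∨ b < v}`. -/
lemma arc_eq_of_bounds {Z : Finset (Fin (n + 1))} {a b : Fin (n + 1)} (ha : a ∈ Z) (hb : b ∈ Z)
    (hab : ∀ i ∈ Z, a ≤ i ∧ i ≤ b) : arc Z = {v | v ≤ a ∨ b < v} := by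
  ext v
  rw [mem_arc]
  constructor
  · rintro (hv | hv)
    · exact Or.inl (hv a ha)
    · exact Or.inr (hv b hb)
  · rintro (hv | hv)
    · exact Or.inl fun i hi => le_trans hv (hab i hi).1
    · exact Or.inr fun i hi => lt_of_le_of_lt (hab i hi).2 hv

/-- The arc of a singleton is everything. -/
lemma arc_singleton (x : Fin (n + 1)) : arc ({x} : Finset (Fin (n + 1))) = Set.univ :=
  arc_of_card_le_one (by simp)

/-- The arc of a nonempty set through its minimum and maximum. -/
lemma arc_eq_min_max {Z : Finset (Fin (n + 1))} (hZ : Z.Nonempty) :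
    arc Z = {v | v ≤ Z.min' hZ ∨ Z.max' hZ < v} :=
  arc_eq_of_bounds (Z.min'_mem hZ) (Z.max'_mem hZ) fun i hi => ⟨Z.min'_le i hi, Z.le_max' i hi⟩

/-! ## The term of the antipodal sum -/

open Classical in
/-- The term of the antipodal 2-colouring sum at the red set `τ ⊆ D`. -/
noncomputable def wt (D : Finset (Fin (n + 1))) (h : Fin (n + 1)) (𝓤 𝓥 : Set (Set (Fin (n + 1))))
    (τ : Finset (Fin (n + 1))) : ℤ :=
  (if h ∈ arc τ then 1 else 0)
    * ((if arc τ ∈ 𝓤 then 1 else 0) - (if arc (D \ τ) ∈ 𝓤 then 1 else 0))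
    * ((if arc τ ∈ 𝓥 then 1 else 0) - (if arc (D \ τ) ∈ 𝓥 then 1 else 0))

/-- The term lies in `{−1, 0, 1}`. -/
lemma wt_mem (D : Finset (Fin (n + 1))) (h : Fin (n + 1)) (𝓤 𝓥 : Set (Set (Fin (n + 1))))
    (τ : Finset (Fin (n + 1))) :
    wt D h 𝓤 𝓥 τ = -1 ∨ wt D h 𝓤 𝓥 τ = 0 ∨ wt D h 𝓤 𝓥 τ = 1 := by
  unfold wt
  split_ifs <;> norm_num

/-- A term equal to `−1`: `h` lies in the red arc, and the two arcs are split by `𝓤` and by `𝓥`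
in opposite ways. -/
lemma of_wt_eq_neg_one {D : Finset (Fin (n + 1))} {h : Fin (n + 1)} {𝓤 𝓥 : Set (Set (Fin (n + 1)))}
    {τ : Finset (Fin (n + 1))} (hw : wt D h 𝓤 𝓥 τ = -1) :
    h ∈ arc τ ∧
      ((arc τ ∈ 𝓤 ∧ arc (D \ τ) ∉ 𝓤 ∧ arc τ ∉ 𝓥 ∧ arc (D \ τ) ∈ 𝓥) ∨
        (arc τ ∉ 𝓤 ∧ arc (D \ τ) ∈ 𝓤 ∧ arc τ ∈ 𝓥 ∧ arc (D \ τ) ∉ 𝓥)) := by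
  unfold wt at hw
  by_cases hh : h ∈ arc τ <;> by_cases a : arc τ ∈ 𝓤 <;> by_cases b : arc (D \ τ) ∈ 𝓤 <;>
    by_cases c : arc τ ∈ 𝓥 <;> by_cases d : arc (D \ τ) ∈ 𝓥 <;>
    simp only [hh, a, b, c, d, if_true, if_false] at hw <;>
    first
    | exact ⟨hh, Or.inl ⟨a, b, c, d⟩⟩
    | exact ⟨hh, Or.inr ⟨a, b, c, d⟩⟩
    | norm_num at hw

/-- A term equal to `1` from the four memberships. -/
lemma wt_eq_one_of {D : Finset (Fin (n + 1))} {h : Fin (n + 1)} {𝓤 𝓥 : Set (Set (Fin (n + 1)))}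
    {τ : Finset (Fin (n + 1))} (hh : h ∈ arc τ) (hU : arc τ ∈ 𝓤) (hV : arc τ ∈ 𝓥)
    (hU' : arc (D \ τ) ∉ 𝓤) (hV' : arc (D \ τ) ∉ 𝓥) : wt D h 𝓤 𝓥 τ = 1 := by
  unfold wt
  simp [hh, hU, hV, hU', hV']

/-- When the red arc is contained in the blue arc the term is nonnegative (both differences are
`≤ 0`). -/
lemma wt_nonneg_of_subset {D : Finset (Fin (n + 1))} {h : Fin (n + 1)}
    {𝓤 𝓥 : Set (Set (Fin (n + 1)))} (hU : IsUpperSet 𝓤) (hV : IsUpperSet 𝓥)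
    {τ : Finset (Fin (n + 1))} (hsub : arc τ ⊆ arc (D \ τ)) : 0 ≤ wt D h 𝓤 𝓥 τ := by
  unfold wt
  by_cases hh : h ∈ arc τ <;> by_cases a : arc τ ∈ 𝓤 <;> by_cases b : arc (D \ τ) ∈ 𝓤 <;>
    by_cases c : arc τ ∈ 𝓥 <;> by_cases d : arc (D \ τ) ∈ 𝓥 <;>
    simp only [hh, a, b, c, d, if_true, if_false] <;>
    first | exact absurd (hU hsub a) b | exact absurd (hV hsub c) d | norm_num

/-- When the blue arc is contained in the red arc the term is nonnegative. -/
lemma wt_nonneg_of_superset {D : Finset (Fin (n + 1))} {h : Fin (n + 1)}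
    {𝓤 𝓥 : Set (Set (Fin (n + 1)))} (hU : IsUpperSet 𝓤) (hV : IsUpperSet 𝓥)
    {τ : Finset (Fin (n + 1))} (hsub : arc (D \ τ) ⊆ arc τ) : 0 ≤ wt D h 𝓤 𝓥 τ := by
  unfold wt
  by_cases hh : h ∈ arc τ <;> by_cases a : arc τ ∈ 𝓤 <;> by_cases b : arc (D \ τ) ∈ 𝓤 <;>
    by_cases c : arc τ ∈ 𝓥 <;> by_cases d : arc (D \ τ) ∈ 𝓥 <;>
    simp only [hh, a, b, c, d, if_true, if_false] <;>
    first | exact absurd (hU hsub b) a | exact absurd (hV hsub d) c | norm_num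

/-! ## The two one-sided types -/

section Types

variable (D : Finset (Fin (n + 1))) (hD : D.Nonempty)

/-- A colouring containing neither extreme position of `D`: the blue arc is the arc of `D`. -/
lemma arc_sdiff_of_neither {τ : Finset (Fin (n + 1))} (h0 : D.min' hD ∉ τ)
    (h1 : D.max' hD ∉ τ) : arc (D \ τ) = arc D := by
  rw [arc_eq_min_max hD]
  refine arc_eq_of_bounds (mem_sdiff.2 ⟨D.min'_mem hD, h0⟩) (mem_sdiff.2 ⟨D.max'_mem hD, h1⟩)
    fun i hi => ⟨D.min'_le i (mem_sdiff.1 hi).1, D.le_max' i (mem_sdiff.1 hi).1⟩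

/-- A colouring containing both extreme positions of `D`: the red arc is the arc of `D`. -/
lemma arc_of_both {τ : Finset (Fin (n + 1))} (hτ : τ ⊆ D) (h0 : D.min' hD ∈ τ)
    (h1 : D.max' hD ∈ τ) : arc τ = arc D := by
  rw [arc_eq_min_max hD]
  exact arc_eq_of_bounds h0 h1 fun i hi => ⟨D.min'_le i (hτ hi), D.le_max' i (hτ hi)⟩

/-- The arc of `D` is contained in the arc of every subset of `D`. -/
lemma arc_D_subset {τ : Finset (Fin (n + 1))} (hτ : τ ⊆ D) : arc D ⊆ arc τ := arc_anti hτ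

/-- Red at the minimum: the red arc is `V ∖ (min D, max τ]`. -/
lemma arc_of_min_mem {τ : Finset (Fin (n + 1))} (hτ : τ ⊆ D) (h0 : D.min' hD ∈ τ) :
    arc τ = {v | v ≤ D.min' hD ∨ τ.max' ⟨_, h0⟩ < v} :=
  arc_eq_of_bounds h0 (τ.max'_mem _) fun i hi => ⟨D.min'_le i (hτ hi), τ.le_max' i hi⟩

/-- Blue at the maximum: the blue arc is `V ∖ (min (D ∖ τ), max D]`. -/
lemma arc_sdiff_of_max_notMem {τ : Finset (Fin (n + 1))} (h1 : D.max' hD ∉ τ) :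
    arc (D \ τ) = {v | v ≤ (D \ τ).min' ⟨_, mem_sdiff.2 ⟨D.max'_mem hD, h1⟩⟩ ∨ D.max' hD < v} :=
  arc_eq_of_bounds ((D \ τ).min'_mem _) (mem_sdiff.2 ⟨D.max'_mem hD, h1⟩)
    fun i hi => ⟨(D \ τ).min'_le i hi, D.le_max' i (mem_sdiff.1 hi).1⟩

/-- Red at the maximum: the red arc is `V ∖ (min τ, max D]`. -/
lemma arc_of_max_mem {τ : Finset (Fin (n + 1))} (hτ : τ ⊆ D) (h1 : D.max' hD ∈ τ) :
    arc τ = {v | v ≤ τ.min' ⟨_, h1⟩ ∨ D.max' hD < v} :=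
  arc_eq_of_bounds (τ.min'_mem _) h1 fun i hi => ⟨τ.min'_le i hi, D.le_max' i (hτ hi)⟩

/-- Blue at the minimum: the blue arc is `V ∖ (min D, max (D ∖ τ)]`. -/
lemma arc_sdiff_of_min_notMem {τ : Finset (Fin (n + 1))} (h0 : D.min' hD ∉ τ) :
    arc (D \ τ) = {v | v ≤ D.min' hD ∨ (D \ τ).max' ⟨_, mem_sdiff.2 ⟨D.min'_mem hD, h0⟩⟩ < v} :=
  arc_eq_of_bounds (mem_sdiff.2 ⟨D.min'_mem hD, h0⟩) ((D \ τ).max'_mem _)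
    fun i hi => ⟨D.min'_le i (mem_sdiff.1 hi).1, (D \ τ).le_max' i hi⟩

end Types

/-! ## The images of the injection -/

section Images

variable (D : Finset (Fin (n + 1)))

/-- The colouring with red hull `[f, l]` obtained from a red set by flipping everything up to `f`:
`f` together with the red positions above `f`. -/
def flipLow (τ : Finset (Fin (n + 1))) (f : Fin (n + 1)) : Finset (Fin (n + 1)) :=
  insert f (τ.filter fun x => f < x)

/-- The colouring with red hull `[f, l]` obtained by flipping everything from `l` on:
`l` together with the red positions below `l`. -/
def flipHigh (τ : Finset (Fin (n + 1))) (l : Fin (n + 1)) : Finset (Fin (n + 1)) :=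
  insert l (τ.filter fun x => x < l)

/-- Membership in `flipLow`. -/
lemma mem_flipLow {τ : Finset (Fin (n + 1))} {f x : Fin (n + 1)} :
    x ∈ flipLow τ f ↔ x = f ∨ (x ∈ τ ∧ f < x) := by
  simp [flipLow]

/-- Membership in `flipHigh`. -/
lemma mem_flipHigh {τ : Finset (Fin (n + 1))} {l x : Fin (n + 1)} :
    x ∈ flipHigh τ l ↔ x = l ∨ (x ∈ τ ∧ x < l) := by
  simp [flipHigh]

/-- The arc of `flipLow τ f` when `l ∈ τ` is the largest red position and `f < l`: `V ∖ (f, l]`. -/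
lemma arc_flipLow {τ : Finset (Fin (n + 1))} {f l : Fin (n + 1)} (hl : l ∈ τ)
    (hmax : ∀ x ∈ τ, x ≤ l) (hfl : f < l) : arc (flipLow τ f) = {v | v ≤ f ∨ l < v} := by
  refine arc_eq_of_bounds (mem_flipLow.2 (Or.inl rfl)) (mem_flipLow.2 (Or.inr ⟨hl, hfl⟩)) ?_
  intro i hi
  rcases mem_flipLow.1 hi with rfl | ⟨hi, hfi⟩
  · exact ⟨le_rfl, hfl.le⟩
  · exact ⟨hfi.le, hmax i hi⟩

/-- The arc of `flipHigh τ l` when `f ∈ τ` is the smallest red position and `f < l`: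
`V ∖ (f, l]`. -/
lemma arc_flipHigh {τ : Finset (Fin (n + 1))} {f l : Fin (n + 1)} (hf : f ∈ τ)
    (hmin : ∀ x ∈ τ, f ≤ x) (hfl : f < l) : arc (flipHigh τ l) = {v | v ≤ f ∨ l < v} := by
  refine arc_eq_of_bounds (mem_flipHigh.2 (Or.inr ⟨hf, hfl⟩)) (mem_flipHigh.2 (Or.inl rfl)) ?_
  intro i hi
  rcases mem_flipHigh.1 hi with rfl | ⟨hi, hil⟩
  · exact ⟨hfl.le, le_rfl⟩
  · exact ⟨hmin i hi, hil.le⟩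

/-- `flipLow τ f ⊆ D` when `τ ⊆ D` and `f ∈ D`. -/
lemma flipLow_subset {τ : Finset (Fin (n + 1))} {f : Fin (n + 1)} (hτ : τ ⊆ D) (hf : f ∈ D) :
    flipLow τ f ⊆ D := by
  intro x hx
  rcases mem_flipLow.1 hx with rfl | ⟨hx, _⟩
  · exact hf
  · exact hτ hx

/-- `flipHigh τ l ⊆ D` when `τ ⊆ D` and `l ∈ D`. -/
lemma flipHigh_subset {τ : Finset (Fin (n + 1))} {l : Fin (n + 1)} (hτ : τ ⊆ D) (hl : l ∈ D) :
    flipHigh τ l ⊆ D := by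
  intro x hx
  rcases mem_flipHigh.1 hx with rfl | ⟨hx, _⟩
  · exact hl
  · exact hτ hx

end Images

/-! ## The injection -/

section Injection

variable (D : Finset (Fin (n + 1))) (hD : D.Nonempty) (h : Fin (n + 1))
  (𝓤 𝓥 : Set (Set (Fin (n + 1))))

open Classical in
/-- The map of the counting proof.  For a red set containing `min D` but not `max D` (first blue
position `f`, last red position `l`): `flipLow τ f` if `f < l`, else the single red edge `{l}`;
symmetrically for `max D` red, `min D` blue; the identity elsewhere.  On the negative colourings it
is injective with positive images when `h` lies strictly inside the hull of `D`
(`min D < h ≤ max D`, proved in the later files of the chain); this hypothesis is essential — for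
`h` in the arc of `D` a red set and its complement can both be negative and share the image. -/
noncomputable def phi (τ : Finset (Fin (n + 1))) : Finset (Fin (n + 1)) :=
  if h0 : D.min' hD ∈ τ ∧ D.max' hD ∉ τ then
    (if (D \ τ).min' ⟨_, mem_sdiff.2 ⟨D.max'_mem hD, h0.2⟩⟩ < τ.max' ⟨_, h0.1⟩ then
      flipLow τ ((D \ τ).min' ⟨_, mem_sdiff.2 ⟨D.max'_mem hD, h0.2⟩⟩)
    else {τ.max' ⟨_, h0.1⟩})
  else if h1 : D.min' hD ∉ τ ∧ D.max' hD ∈ τ then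
    (if τ.min' ⟨_, h1.2⟩ < (D \ τ).max' ⟨_, mem_sdiff.2 ⟨D.min'_mem hD, h1.1⟩⟩ then
      flipHigh τ ((D \ τ).max' ⟨_, mem_sdiff.2 ⟨D.min'_mem hD, h1.1⟩⟩)
    else {τ.min' ⟨_, h1.2⟩})
  else τ

/-- The negative colourings. -/
noncomputable def negSet : Finset (Finset (Fin (n + 1))) :=
  D.powerset.filter fun τ => wt D h 𝓤 𝓥 τ = -1

/-- The positive colourings. -/
noncomputable def posSet : Finset (Finset (Fin (n + 1))) :=
  D.powerset.filter fun τ => wt D h 𝓤 𝓥 τ = 1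

/-- The antipodal sum is the number of positive colourings minus the number of negative ones. -/
lemma sum_wt_eq_card_sub_card :
    ∑ τ ∈ D.powerset, wt D h 𝓤 𝓥 τ = ((posSet D h 𝓤 𝓥).card : ℤ) - (negSet D h 𝓤 𝓥).card := by
  unfold posSet negSet
  rw [card_filter, card_filter]
  push_cast
  rw [← sum_sub_distrib]
  refine sum_congr rfl fun τ _ => ?_
  rcases wt_mem D h 𝓤 𝓥 τ with hw | hw | hw <;> rw [hw] <;> norm_num

end Injection

/-! ## Negative colourings contain exactly one extreme position -/

section Negatives

variable {D : Finset (Fin (n + 1))} (hD : D.Nonempty) {h : Fin (n + 1)}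
  {𝓤 𝓥 : Set (Set (Fin (n + 1)))}

/-- A negative colouring does not contain both extreme positions. -/
lemma not_both_of_neg (hU : IsUpperSet 𝓤) (hV : IsUpperSet 𝓥) {τ : Finset (Fin (n + 1))}
    (hτ : τ ⊆ D) (hw : wt D h 𝓤 𝓥 τ = -1) :
    ¬ (D.min' hD ∈ τ ∧ D.max' hD ∈ τ) := by
  rintro ⟨h0, h1⟩
  have := wt_nonneg_of_subset (D := D) (h := h) hU hV
    (τ := τ) (by rw [arc_of_both D hD hτ h0 h1]; exact arc_D_subset D sdiff_subset)
  omega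

/-- A negative colouring contains at least one extreme position. -/
lemma not_neither_of_neg (hU : IsUpperSet 𝓤) (hV : IsUpperSet 𝓥) {τ : Finset (Fin (n + 1))}
    (hτ : τ ⊆ D) (hw : wt D h 𝓤 𝓥 τ = -1) :
    ¬ (D.min' hD ∉ τ ∧ D.max' hD ∉ τ) := by
  rintro ⟨h0, h1⟩
  have := wt_nonneg_of_superset (D := D) (h := h) hU hV
    (τ := τ) (by rw [arc_sdiff_of_neither D hD h0 h1]; exact arc_D_subset D hτ)
  omega

/-- For a negative colouring the arc of `D` lies in neither family and everything lies in both. -/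
lemma arc_D_notMem_of_neg (hU : IsUpperSet 𝓤) (hV : IsUpperSet 𝓥) {τ : Finset (Fin (n + 1))}
    (hτ : τ ⊆ D) (hw : wt D h 𝓤 𝓥 τ = -1) :
    arc D ∉ 𝓤 ∧ arc D ∉ 𝓥 ∧ (Set.univ : Set (Fin (n + 1))) ∈ 𝓤 ∧
      (Set.univ : Set (Fin (n + 1))) ∈ 𝓥 := by
  obtain ⟨-, hc⟩ := of_wt_eq_neg_one hw
  have hsub1 : arc D ⊆ arc τ := arc_D_subset D hτ
  have hsub2 : arc D ⊆ arc (D \ τ) := arc_D_subset D sdiff_subset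
  have hu1 : arc τ ⊆ Set.univ := Set.subset_univ _
  have hu2 : arc (D \ τ) ⊆ Set.univ := Set.subset_univ _
  rcases hc with ⟨hU1, hU2, hV1, hV2⟩ | ⟨hU1, hU2, hV1, hV2⟩
  · exact ⟨fun hm => hU2 (hU hsub2 hm), fun hm => hV1 (hV hsub1 hm), hU hu1 hU1, hV hu2 hV2⟩
  · exact ⟨fun hm => hU1 (hU hsub1 hm), fun hm => hV2 (hV hsub2 hm), hU hu2 hU2, hV hu1 hV1⟩

end Negatives

end TCycle

end Summit.Ventures.PercRepro2
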